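import Summits.QuantumFields.YangMills.Theorems.BalabanUVNodesN15KingModelCoverUnitBridge
import Summits.QuantumFields.YangMills.Theorems.BalabanUVNodesN15KingModelCoverPureGauge
import HarnessLib

/-!
# BalabanUVNodes ∕ N15 — THE KING-MODEL RUNG (PART Ͻ-f): FINITE COVERS — GAUGE COVARIANCE OF KING's BLOCK-SPIN OBJECTS AT A TORON OF TRIVIAL HOLONOMY: the covariant block mean
# intertwines the fine and the unit-lattice character gauges (`Q^ω = D_c^*·Q^1·D_f`), so `A₀(ω) = D_f^*A₀(1)D_f`, `Δ^ω_eff = D_c^*·Δ^1_eff·D_c` and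
# `(Δ^ω_eff)⁻¹(b,b′) = χ̄(Nb)·(King1986.effLaplacian)⁻¹(b,b′)·χ(Nb′)` — King's BLOCK-FIELD COVARIANCE AT A TORON HAS EXACTLY KING's `A = 0` MODULI; two spacings with the same
# holonomy per unit length carry the SAME unit-lattice phases, so their DIFFERENCE has exactly the modulus of the tree's `A = 0` difference
# (Track A, DAG node N15 = NE2; FAN-OUT v1.1 §N15 s3 «KING-MODEL RUNG … + what the curved case adds»; count-neutral)

HONEST FRAMING.  Count-neutral (cell `pub-ymgap`, seat `pub-ymgap-dag-n15-e` g45; `--supports stmt-QuantumFields-27247 --as helper` = K3ᴬ, KEY MAP v3).  King's `A = 0`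
comparison model [King1986] at a constant abelian (flat) link field whose phases are roots of unity of the FINE torus periods (trivial holonomy — the situation on a covering torus,
PART Ͻ-d); block-spin letters of PART Ͷ-k (`QsOpTw` of `B5ToronOperators118`, [Balaban1985BackgroundPropagators] (3.19) p.393; King's (2.11)–(2.14) p.653).  Exact identities;
NOT Bałaban's `G_k(U)`; NOT a node discharge (N15 of record untouched); nothing continuum ∕ ℝ⁴ ∕ OS ∕ Clay.

THE MATHEMATICS.  Let `F = T_{NM′}` be the fine torus over the unit torus `T_{M′}`, `p ∈ F` with `χ_p(e_μ) = ω_μ`.  Characters are multiplicative along King's block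
parametrisation: `χ_p(Ny + j) = χ_p(Ny)·ω^j` (`chi_bpt`) and `χ_p(Ny) = Π_ν(ω_ν^N)^{y_ν}` (`chi_up_eq_prod_pow` — a function of the UNIT-LATTICE PHASES `θ_ν = ω_ν^N` alone).  Hence
the twisted block mean `Q^ω(y, Ny+j) = ω^jN^{−(d+1)}` is `χ̄_p(Ny)·Q^1(y,·)·χ_p(·)`: `Q^ω = D_c^*Q^1D_f` with `D_f = diag χ_p`, `D_c = diag(y ↦ χ_p(Ny))` ([Balaban1985BackgroundPropagators]
(3.20) p.393: the averaging is gauge covariant).  With PART Ͻ-d's `M_ω = D_f^*M_1D_f`: `A₀(ω) = D_f^*A₀(1)D_f`, `Δ^ω_eff = a − a²Q^ωG(ω)Q^{ω*} = D_c^*Δ^1_effD_c`, and by PART Ͻ-g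
`(Δ^ω_eff)⁻¹(b,b′) = χ̄_p(Nb)·((King1986.effLaplacian N M′ a c m²)⁻¹(b,b′))·χ_p(Nb′)`.
PROVED HERE:
* §1 `stdAddChar_mul_natCast`, ★ `chi_iota_eq_twPow` (`χ_p(j) = ω^j`), ★ `chi_up_eq_prod_pow` (`χ_p(Ny) = Π_ν(ω_ν^N)^{val y_ν}`), `chi_bpt`, `coarsePhase_mul_conj` (unit modulus),
  `coarseDiag_mul_conjTranspose` ∕ `conjTranspose_mul_coarseDiag`;
* §2 ★★★ **`QsOpTw_eq_char_conj`** (`Q^ω = D_c^*·Q^1·D_f`), ★★ `kingQadjTw_eq_char_conj` (`Q^{ω*} = D_f^*·Q^{1*}·D_c`), ★★ `fineOpTw_eq_char_conj` (`A₀(ω) = D_f^*A₀(1)D_f`), `fineOpTw_inv_eq_char_conj`,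
  ★★★ **`effLapTw_eq_char_conj`** (`Δ^ω_eff = D_c^*·Δ^1_eff·D_c`), ★★★ **`effLapTw_inv_eq_char_conj`**;
* §3 ★★★ **`effLapTw_inv_apply_eq_char_effLaplacian`** (`(Δ^ω_eff)⁻¹(b,b′) = χ̄_p(Nb)·((effLaplacian)⁻¹(b,b′) : ℂ)·χ_p(Nb′)`), ★★ **`norm_effLapTw_inv_apply_eq`** (`= |(effLaplacian)⁻¹(b,b′)|`),
  ★★★ **`norm_effLapTw_inv_sub_apply_eq`** (two spacings `N₁, N₂` with the same unit-lattice phases `ω₁^{N₁} = ω₂^{N₂}`: the modulus of the difference of the toron block covariances IS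
  the modulus of the tree's `A = 0` difference `(Δ^{(k+n)})⁻¹ − (Δ^{(k)})⁻¹`).
PRIOR TREE ART (by name): Ͻ-b (`exists_bpt_eq`), Ͻ-d (`toronOp_eq_char_conj`, `charDiag_mul_conjTranspose`, `conjTranspose_mul_charDiag`, `conj_chi_mul_chi`), Ͻ-e (`QsOpTw_apply_bpt`), Ͻ-g
(`effLapTw_one_inv_apply`), Ͷ-k (`kingQadjTw`, `fineOpTw`, `effLapTw`, `isUnit_fineOpTw`), Ͷ-n (`isUnit_effLapTw`), Ͷ-c (`chi_mul_conj`), `B5Prop11Plancherel` (`chi`, `chi_add_right`,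
`chi_unitVec`), `B5Block118` (`bpt`, `up`, `iota`, `upHom_intCast`), `B5ToronOperators118` (`QsOpTw`, `twPow`, `twPow_one`), Mathlib (`AddChar.map_nsmul_eq_pow`).  Dedup (rg at filing):
basename 0 files; needles `QsOpTw_eq_char_conj|effLapTw_eq_char_conj|chi_up_eq_prod_pow|norm_effLapTw_inv_sub_apply_eq` 0 tree files.  presearch: n/a (composition of in-tree theorems).
Locators: [King1986] (2.11)–(2.14) p.653, (2.16) p.653, (4.5) p.670, (4.38) p.674; [Balaban1985BackgroundPropagators] (3.19)–(3.20) p.393, p.398 l.19; [Balaban1984PropagatorsI] (1.74) p.30.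
0 `sorry`, 0 `def`.
-/

noncomputable section

open scoped BigOperators ComplexConjugate ComplexOrder
open Finset Matrix

namespace Summit.QuantumFields.YangMills.BalabanUVNodes.N15KingModelRung.Cover

open Literature.MathematicalPhysics.QuantumFieldTheory.Balaban1983to89.B5Prop11Plancherel (Tor unitVec fine chi chi_add_right chi_unitVec)
open Literature.MathematicalPhysics.QuantumFieldTheory.Balaban1983to89.B5Block118 (bpt up iota upHom_intCast)
open Literature.MathematicalPhysics.QuantumFieldTheory.Balaban1983to89.B5ToronOperators118 (QsOpTw twPow twPow_one)
open Literature.MathematicalPhysics.QuantumFieldTheory.King1986.Torus (effLaplacian corner_eq_up)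
open Summit.QuantumFields.YangMills.BalabanUVNodes.N15KingModelRung.Toron (toronOp kingQadjTw fineOpTw effLapTw isUnit_fineOpTw isUnit_effLapTw chi_mul_conj)

variable {d : ℕ} (N : ℕ) [NeZero N] (M : Fin (d + 1) → ℕ) [hM : ∀ μ, NeZero (M μ)]

/-! ## §1 Characters along King's block parametrisation -/

/-- `ψ(a·k) = ψ(a)^k` for the standard additive character and a natural number `k`. [folklore] -/
theorem stdAddChar_mul_natCast {n : ℕ} [NeZero n] (a : ZMod n) (k : ℕ) :
    (ZMod.stdAddChar (N := n)) (a * (k : ZMod n)) = (ZMod.stdAddChar (N := n)) a ^ k := by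
  rw [mul_comm, ← nsmul_eq_mul, AddChar.map_nsmul_eq_pow]

/-- ★ THE CHARACTER OF A BLOCK OFFSET IS THE TRANSPORT PHASE: `χ_p(j) = Π_ν χ_p(e_ν)^{j_ν} = ω^j` (`twPow`). [cite: Balaban1985BackgroundPropagators, (3.19) p.393] -/
theorem chi_iota_eq_twPow (p : Tor (fine N M)) (j : Fin (d + 1) → Fin N) :
    chi (fine N M) p (iota N M j) = twPow N (fun ν => chi (fine N M) p (unitVec (fine N M) ν)) j := by
  simp only [chi_unitVec]
  simp only [chi, iota, twPow, stdAddChar_mul_natCast]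

/-- ★ THE CHARACTER OF A UNIT-LATTICE POINT DEPENDS ONLY ON THE UNIT-LATTICE PHASES `θ_ν = χ_p(e_ν)^N`: `χ_p(Ny) = Π_ν (χ_p(e_ν)^N)^{val y_ν}`.
[cite: King1986, (2.11) p.653; Balaban1985BackgroundPropagators, (3.19) p.393] -/
theorem chi_up_eq_prod_pow (p : Tor (fine N M)) (y : Tor M) :
    chi (fine N M) p (up N M y) = ∏ ν, (chi (fine N M) p (unitVec (fine N M) ν) ^ N) ^ (y ν).val := by
  simp only [chi_unitVec]
  simp only [chi]
  refine Finset.prod_congr rfl fun ν _ => ?_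
  rw [show up N M y ν = ((N * (y ν).val : ℕ) : ZMod (fine N M ν)) from (congrFun (corner_eq_up N M y) ν).symm, stdAddChar_mul_natCast, pow_mul]

/-- The character at a block point factorises: `χ_p(Ny + j) = χ_p(Ny)·ω^j`. [cite: Balaban1985BackgroundPropagators, (3.19) p.393] -/
theorem chi_bpt (p : Tor (fine N M)) (y : Tor M) (j : Fin (d + 1) → Fin N) :
    chi (fine N M) p (bpt N M y j) = chi (fine N M) p (up N M y) * twPow N (fun ν => chi (fine N M) p (unitVec (fine N M) ν)) j := by
  rw [bpt, chi_add_right, chi_iota_eq_twPow]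

/-- The unit-lattice phases have modulus one: `χ_p(Ny)·χ̄_p(Ny) = 1`. [folklore] -/
theorem coarsePhase_mul_conj (p : Tor (fine N M)) (y : Tor M) : chi (fine N M) p (up N M y) * conj (chi (fine N M) p (up N M y)) = 1 :=
  chi_mul_conj (fine N M) p (up N M y)

/-- `D_c·D_c^* = 1` for `D_c = diag(y ↦ χ_p(Ny))`. [folklore] -/
theorem coarseDiag_mul_conjTranspose (p : Tor (fine N M)) :
    diagonal (fun y : Tor M => chi (fine N M) p (up N M y)) * (diagonal (fun y : Tor M => chi (fine N M) p (up N M y)))ᴴ = 1 := by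
  rw [Matrix.diagonal_conjTranspose, Matrix.diagonal_mul_diagonal, ← Matrix.diagonal_one]
  congr 1; funext y
  rw [Pi.star_apply, Complex.star_def, coarsePhase_mul_conj]

/-- `D_c^*·D_c = 1`. [folklore] -/
theorem conjTranspose_mul_coarseDiag (p : Tor (fine N M)) :
    (diagonal (fun y : Tor M => chi (fine N M) p (up N M y)))ᴴ * diagonal (fun y : Tor M => chi (fine N M) p (up N M y)) = 1 := by
  rw [Matrix.diagonal_conjTranspose, Matrix.diagonal_mul_diagonal, ← Matrix.diagonal_one]
  congr 1; funext y
  rw [Pi.star_apply, Complex.star_def, mul_comm, coarsePhase_mul_conj]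

/-! ## §2 The block-spin objects at the toron are character gauges of their `ω ≡ 1` versions -/

/-- ★★★ **THE COVARIANT BLOCK MEAN INTERTWINES THE TWO CHARACTER GAUGES**: `Q^ω = D_c^*·Q^1·D_f` whenever `χ_p(e_μ) = ω_μ` (`D_f = diag χ_p` on the fine torus, `D_c = diag(y ↦ χ_p(Ny))`
on the unit torus) — gauge covariance of the averaging at a constant background. [cite: Balaban1985BackgroundPropagators, (3.19)–(3.20) p.393; King1986, (2.11) p.653] -/
theorem QsOpTw_eq_char_conj {p : Tor (fine N M)} {ω : Fin (d + 1) → ℂ} (hp : ∀ μ, chi (fine N M) p (unitVec (fine N M) μ) = ω μ) :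
    QsOpTw N M ω = (diagonal (fun y : Tor M => chi (fine N M) p (up N M y)))ᴴ * QsOpTw N M (1 : Fin (d + 1) → ℂ) * diagonal (chi (fine N M) p) := by
  have hω : (fun ν => chi (fine N M) p (unitVec (fine N M) ν)) = ω := funext hp
  ext y x
  obtain ⟨b, j, rfl⟩ := exists_bpt_eq N (M := M) x
  rw [Matrix.mul_diagonal, Matrix.diagonal_conjTranspose, Matrix.diagonal_mul, QsOpTw_apply_bpt, QsOpTw_apply_bpt, Pi.star_apply, Complex.star_def, twPow_one]
  by_cases hyb : y = b
  · subst hyb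
    rw [if_pos rfl, if_pos rfl, chi_bpt, hω]
    calc twPow N ω j / (N : ℂ) ^ (d + 1)
        = (chi (fine N M) p (up N M y) * conj (chi (fine N M) p (up N M y))) * twPow N ω j / (N : ℂ) ^ (d + 1) := by rw [coarsePhase_mul_conj, one_mul]
      _ = conj (chi (fine N M) p (up N M y)) * (1 / (N : ℂ) ^ (d + 1)) * (chi (fine N M) p (up N M y) * twPow N ω j) := by ring
  · rw [if_neg hyb, if_neg hyb, mul_zero, zero_mul]

/-- ★★ **KING's `η`-ADJOINT TRANSFORMS DUALLY**: `Q^{ω*} = D_f^*·Q^{1*}·D_c`. [cite: Balaban1985BackgroundPropagators, (3.20) p.393; King1986, (2.13) p.653] -/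
theorem kingQadjTw_eq_char_conj {p : Tor (fine N M)} {ω : Fin (d + 1) → ℂ} (hp : ∀ μ, chi (fine N M) p (unitVec (fine N M) μ) = ω μ) :
    kingQadjTw N M ω = (diagonal (chi (fine N M) p))ᴴ * kingQadjTw N M (1 : Fin (d + 1) → ℂ) * diagonal (fun y : Tor M => chi (fine N M) p (up N M y)) := by
  rw [kingQadjTw, kingQadjTw, QsOpTw_eq_char_conj N M hp, Matrix.conjTranspose_mul, Matrix.conjTranspose_mul, Matrix.conjTranspose_conjTranspose]
  simp only [Matrix.smul_mul, Matrix.mul_smul, Matrix.mul_assoc]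

/-- ★★ **KING's FULL FINE OPERATOR AT THE TORON IS THE FINE CHARACTER GAUGE OF `A₀(1)`**: `A₀(ω) = D_f^*·A₀(1)·D_f`. [cite: King1986, (2.13) p.653; Balaban1985BackgroundPropagators, p.398 l.19] -/
theorem fineOpTw_eq_char_conj (a c m2 : ℝ) {p : Tor (fine N M)} {ω : Fin (d + 1) → ℂ} (hp : ∀ μ, chi (fine N M) p (unitVec (fine N M) μ) = ω μ) :
    fineOpTw N M a c m2 ω = (diagonal (chi (fine N M) p))ᴴ * fineOpTw N M a c m2 (1 : Fin (d + 1) → ℂ) * diagonal (chi (fine N M) p) := by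
  rw [fineOpTw, fineOpTw, toronOp_eq_char_conj (fine N M) c m2 hp, kingQadjTw_eq_char_conj N M hp, QsOpTw_eq_char_conj N M hp]
  set Df := diagonal (chi (fine N M) p)
  set Dc := diagonal (fun y : Tor M => chi (fine N M) p (up N M y))
  have hcc : Dc * Dcᴴ = 1 := coarseDiag_mul_conjTranspose N M p
  calc Dfᴴ * toronOp (fine N M) c m2 1 * Df + (a : ℂ) • (Dfᴴ * kingQadjTw N M 1 * Dc * (Dcᴴ * QsOpTw N M 1 * Df))
      = Dfᴴ * toronOp (fine N M) c m2 1 * Df + (a : ℂ) • (Dfᴴ * kingQadjTw N M 1 * (Dc * Dcᴴ) * QsOpTw N M 1 * Df) := by simp only [Matrix.mul_assoc]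
    _ = Dfᴴ * (toronOp (fine N M) c m2 1 + (a : ℂ) • (kingQadjTw N M 1 * QsOpTw N M 1)) * Df := by
        rw [hcc, Matrix.mul_one, Matrix.mul_add, Matrix.add_mul, Matrix.mul_smul, Matrix.smul_mul, Matrix.mul_assoc Dfᴴ (kingQadjTw N M 1), Matrix.mul_assoc Dfᴴ]

/-- ★★ Its inverse (King's full propagator): `G(ω) = D_f^*·G(1)·D_f` (`a, c ≥ 0`, `m² > 0`). [cite: King1986, (2.13) p.653; Balaban1985BackgroundPropagators, p.398 l.19] -/
theorem fineOpTw_inv_eq_char_conj {a c m2 : ℝ} (ha : 0 ≤ a) (hc : 0 ≤ c) (hm : 0 < m2) {p : Tor (fine N M)} {ω : Fin (d + 1) → ℂ}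
    (hp : ∀ μ, chi (fine N M) p (unitVec (fine N M) μ) = ω μ) :
    (fineOpTw N M a c m2 ω)⁻¹ = (diagonal (chi (fine N M) p))ᴴ * (fineOpTw N M a c m2 (1 : Fin (d + 1) → ℂ))⁻¹ * diagonal (chi (fine N M) p) := by
  have hu : IsUnit (fineOpTw N M a c m2 (1 : Fin (d + 1) → ℂ)).det := (Matrix.isUnit_iff_isUnit_det _).mp (isUnit_fineOpTw N M ha hc hm (by simp))
  refine Matrix.inv_eq_left_inv ?_
  rw [fineOpTw_eq_char_conj N M a c m2 hp]
  set Df := diagonal (chi (fine N M) p)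
  calc Dfᴴ * (fineOpTw N M a c m2 1)⁻¹ * Df * (Dfᴴ * fineOpTw N M a c m2 1 * Df)
      = Dfᴴ * (fineOpTw N M a c m2 1)⁻¹ * (Df * Dfᴴ) * fineOpTw N M a c m2 1 * Df := by simp only [Matrix.mul_assoc]
    _ = 1 := by
        rw [charDiag_mul_conjTranspose, Matrix.mul_one, Matrix.mul_assoc _ ((fineOpTw N M a c m2 1)⁻¹), Matrix.nonsing_inv_mul _ hu, Matrix.mul_one, conjTranspose_mul_charDiag]

/-- ★★★ **KING's EFFECTIVE LAPLACIAN AT THE TORON IS THE UNIT-LATTICE CHARACTER GAUGE OF `Δ^1_eff`**: `Δ^ω_eff = D_c^*·Δ^1_eff·D_c` (`a, c ≥ 0`, `m² > 0`, `χ_p(e_μ) = ω_μ`).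
[cite: King1986, (2.14) p.653, (4.5) p.670; Balaban1985BackgroundPropagators, (3.20) p.393, p.398 l.19] -/
theorem effLapTw_eq_char_conj {a c m2 : ℝ} (ha : 0 ≤ a) (hc : 0 ≤ c) (hm : 0 < m2) {p : Tor (fine N M)} {ω : Fin (d + 1) → ℂ}
    (hp : ∀ μ, chi (fine N M) p (unitVec (fine N M) μ) = ω μ) :
    effLapTw N M a c m2 ω
      = (diagonal (fun y : Tor M => chi (fine N M) p (up N M y)))ᴴ * effLapTw N M a c m2 (1 : Fin (d + 1) → ℂ) * diagonal (fun y : Tor M => chi (fine N M) p (up N M y)) := by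
  rw [effLapTw, effLapTw, fineOpTw_inv_eq_char_conj N M ha hc hm hp, kingQadjTw_eq_char_conj N M hp, QsOpTw_eq_char_conj N M hp]
  set Df := diagonal (chi (fine N M) p)
  set Dc := diagonal (fun y : Tor M => chi (fine N M) p (up N M y))
  have hff : Df * Dfᴴ = 1 := charDiag_mul_conjTranspose (fine N M) p
  have hcc' : Dcᴴ * Dc = 1 := conjTranspose_mul_coarseDiag N M p
  set G := (fineOpTw N M a c m2 (1 : Fin (d + 1) → ℂ))⁻¹
  set Q := QsOpTw N M (1 : Fin (d + 1) → ℂ)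
  set Qs := kingQadjTw N M (1 : Fin (d + 1) → ℂ)
  calc (a : ℂ) • (1 : Matrix (Tor M) (Tor M) ℂ) - ((a : ℂ) ^ 2) • (Dcᴴ * Q * Df * (Dfᴴ * G * Df) * (Dfᴴ * Qs * Dc))
      = (a : ℂ) • (Dcᴴ * Dc) - ((a : ℂ) ^ 2) • (Dcᴴ * Q * (Df * Dfᴴ) * G * (Df * Dfᴴ) * Qs * Dc) := by rw [hcc']; simp only [Matrix.mul_assoc]
    _ = Dcᴴ * ((a : ℂ) • (1 : Matrix (Tor M) (Tor M) ℂ) - ((a : ℂ) ^ 2) • (Q * G * Qs)) * Dc := by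
        rw [hff, Matrix.mul_one, Matrix.mul_one, Matrix.mul_sub, Matrix.sub_mul, Matrix.mul_smul, Matrix.smul_mul, Matrix.mul_one, Matrix.mul_smul, Matrix.smul_mul]
        simp only [Matrix.mul_assoc]

/-- ★★★ **THE BLOCK-FIELD COVARIANCE AT THE TORON**: `(Δ^ω_eff)⁻¹ = D_c^*·(Δ^1_eff)⁻¹·D_c` (`a > 0`, `c ≥ 0`, `m² > 0`). [cite: King1986, (2.16) p.653, (4.38) p.674; Balaban1985BackgroundPropagators, p.398 l.19] -/
theorem effLapTw_inv_eq_char_conj {a c m2 : ℝ} (ha : 0 < a) (hc : 0 ≤ c) (hm : 0 < m2) {p : Tor (fine N M)} {ω : Fin (d + 1) → ℂ}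
    (hp : ∀ μ, chi (fine N M) p (unitVec (fine N M) μ) = ω μ) :
    (effLapTw N M a c m2 ω)⁻¹
      = (diagonal (fun y : Tor M => chi (fine N M) p (up N M y)))ᴴ * (effLapTw N M a c m2 (1 : Fin (d + 1) → ℂ))⁻¹ * diagonal (fun y : Tor M => chi (fine N M) p (up N M y)) := by
  have hu : IsUnit (effLapTw N M a c m2 (1 : Fin (d + 1) → ℂ)).det := (Matrix.isUnit_iff_isUnit_det _).mp (isUnit_effLapTw N M ha hc hm (by simp))
  refine Matrix.inv_eq_left_inv ?_
  rw [effLapTw_eq_char_conj N M ha.le hc hm hp]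
  set Dc := diagonal (fun y : Tor M => chi (fine N M) p (up N M y))
  calc Dcᴴ * (effLapTw N M a c m2 1)⁻¹ * Dc * (Dcᴴ * effLapTw N M a c m2 1 * Dc)
      = Dcᴴ * (effLapTw N M a c m2 1)⁻¹ * (Dc * Dcᴴ) * effLapTw N M a c m2 1 * Dc := by simp only [Matrix.mul_assoc]
    _ = 1 := by
        rw [coarseDiag_mul_conjTranspose, Matrix.mul_one, Matrix.mul_assoc _ ((effLapTw N M a c m2 1)⁻¹), Matrix.nonsing_inv_mul _ hu, Matrix.mul_one,
          conjTranspose_mul_coarseDiag]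

/-! ## §3 The toron block-field covariance has King's `A = 0` moduli -/

/-- ★★★ **`(Δ^ω_eff)⁻¹(b,b′) = χ̄_p(Nb)·((King1986.effLaplacian N M a c m²)⁻¹(b,b′) : ℂ)·χ_p(Nb′)`** (`a > 0`, `c ≥ 0`, `m² > 0`, `χ_p(e_μ) = ω_μ`) — King's block-field covariance at a
toron of trivial holonomy is King's PRINTED `A = 0` covariance dressed by unit-lattice phases. [cite: King1986, (2.16) p.653, (4.38) p.674; Balaban1985BackgroundPropagators, p.398 l.19] -/
theorem effLapTw_inv_apply_eq_char_effLaplacian {a c m2 : ℝ} (ha : 0 < a) (hc : 0 ≤ c) (hm : 0 < m2) {p : Tor (fine N M)} {ω : Fin (d + 1) → ℂ}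
    (hp : ∀ μ, chi (fine N M) p (unitVec (fine N M) μ) = ω μ) (b b' : Tor M) :
    (effLapTw N M a c m2 ω)⁻¹ b b' = conj (chi (fine N M) p (up N M b)) * (((effLaplacian N M a c m2)⁻¹ b b' : ℝ) : ℂ) * chi (fine N M) p (up N M b') := by
  rw [effLapTw_inv_eq_char_conj N M ha hc hm hp, Matrix.mul_apply]
  simp only [Matrix.diagonal_conjTranspose, Matrix.diagonal_mul, Pi.star_apply, Complex.star_def, effLapTw_one_inv_apply N M ha hc hm]
  rw [Finset.sum_eq_single b' (fun z _ hz => by rw [Matrix.diagonal_apply_ne _ hz, mul_zero]) (fun h => absurd (Finset.mem_univ b') h), Matrix.diagonal_apply_eq]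

/-- ★★ **EXACTLY KING's MODULI**: `‖(Δ^ω_eff)⁻¹(b,b′)‖ = |(King1986.effLaplacian N M a c m²)⁻¹(b,b′)|` whenever `ω_μ^{NM_μ} = 1` for all `μ` (trivial holonomy).
[cite: King1986, (4.38) p.674; Balaban1985BackgroundPropagators, p.398 l.19] -/
theorem norm_effLapTw_inv_apply_eq {a c m2 : ℝ} (ha : 0 < a) (hc : 0 ≤ c) (hm : 0 < m2) {ω : Fin (d + 1) → ℂ} (hω : ∀ μ, ω μ ^ fine N M μ = 1) (b b' : Tor M) :
    ‖(effLapTw N M a c m2 ω)⁻¹ b b'‖ = |(effLaplacian N M a c m2)⁻¹ b b'| := by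
  obtain ⟨p, hp⟩ := exists_char_of_pow_eq_one (fine N M) hω
  rw [effLapTw_inv_apply_eq_char_effLaplacian N M ha hc hm hp, norm_mul, norm_mul, Complex.norm_conj,
    Summit.QuantumFields.YangMills.BalabanUVNodes.N15KingModelRung.TorusSpectral.norm_chi_eq_one,
    Summit.QuantumFields.YangMills.BalabanUVNodes.N15KingModelRung.TorusSpectral.norm_chi_eq_one, one_mul, mul_one, Complex.norm_real, Real.norm_eq_abs]

/-- ★★★ **TWO SPACINGS, SAME HOLONOMY PER UNIT LENGTH ⇒ THE DIFFERENCE HAS KING's `A = 0` MODULUS EXACTLY**: on one unit torus `T_M` let `N₁, N₂` be two fine spacings with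
phase vectors `ω₁, ω₂` of trivial holonomy (`χ_{p_i}(e_μ) = ω_{i,μ}` on `T_{N_iM}`) and EQUAL unit-lattice phases `χ_{p₁}(e_μ)^{N₁} = χ_{p₂}(e_μ)^{N₂}` (`ω₁^{N₁} = ω₂^{N₂}`: the same
constant gauge field read at two lattice spacings); then `‖(Δ^{ω₁}_{eff,N₁})⁻¹(b,b′) − (Δ^{ω₂}_{eff,N₂})⁻¹(b,b′)‖ = |(effLaplacian N₁ …)⁻¹(b,b′) − (effLaplacian N₂ …)⁻¹(b,b′)|` — King's
Lemma 4.5 two-spacing difference at a toron has the modulus of the printed `A = 0` difference. [cite: King1986, Lemma 4.5 (4.38) p.674] -/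
theorem norm_effLapTw_inv_sub_apply_eq (N₁ N₂ : ℕ) [NeZero N₁] [NeZero N₂] {a₁ a₂ c₁ c₂ m2 : ℝ} (ha₁ : 0 < a₁) (ha₂ : 0 < a₂) (hc₁ : 0 ≤ c₁) (hc₂ : 0 ≤ c₂) (hm : 0 < m2)
    {p₁ : Tor (fine N₁ M)} {p₂ : Tor (fine N₂ M)} {ω₁ ω₂ : Fin (d + 1) → ℂ}
    (hp₁ : ∀ μ, chi (fine N₁ M) p₁ (unitVec (fine N₁ M) μ) = ω₁ μ) (hp₂ : ∀ μ, chi (fine N₂ M) p₂ (unitVec (fine N₂ M) μ) = ω₂ μ)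
    (hθ : ∀ μ, chi (fine N₁ M) p₁ (unitVec (fine N₁ M) μ) ^ N₁ = chi (fine N₂ M) p₂ (unitVec (fine N₂ M) μ) ^ N₂) (b b' : Tor M) :
    ‖(effLapTw N₁ M a₁ c₁ m2 ω₁)⁻¹ b b' - (effLapTw N₂ M a₂ c₂ m2 ω₂)⁻¹ b b'‖
      = |(effLaplacian N₁ M a₁ c₁ m2)⁻¹ b b' - (effLaplacian N₂ M a₂ c₂ m2)⁻¹ b b'| := by
  have hup : ∀ y : Tor M, chi (fine N₁ M) p₁ (up N₁ M y) = chi (fine N₂ M) p₂ (up N₂ M y) := fun y => by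
    rw [chi_up_eq_prod_pow, chi_up_eq_prod_pow]; simp only [hθ]
  rw [effLapTw_inv_apply_eq_char_effLaplacian N₁ M ha₁ hc₁ hm hp₁, effLapTw_inv_apply_eq_char_effLaplacian N₂ M ha₂ hc₂ hm hp₂, hup b, hup b', ← sub_mul, ← mul_sub,
    ← Complex.ofReal_sub, norm_mul, norm_mul, Complex.norm_conj, Summit.QuantumFields.YangMills.BalabanUVNodes.N15KingModelRung.TorusSpectral.norm_chi_eq_one,
    Summit.QuantumFields.YangMills.BalabanUVNodes.N15KingModelRung.TorusSpectral.norm_chi_eq_one, one_mul, mul_one, Complex.norm_real, Real.norm_eq_abs]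

end Summit.QuantumFields.YangMills.BalabanUVNodes.N15KingModelRung.Cover

end
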